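import Summits.QuantumFields.YangMills.Theses.SlackWindow
import Summits.QuantumFields.YangMills.Theorems.InfiniteVolumePerOrderSlackLargeIVData
import Summits.QuantumFields.YangMills.Theorems.OnsetCalibrationOnsetVanishes

/-!
# Route `SlackWindow` (ym-idea-11 g10 sub-route «√-domination × mirror») — the support item `SlackLargeCalibration` (stmt-QuantumFields-23561), PROVED

`SlackLargeCalibration`: the LARGE-VOLUME slack factorial sub-onset ceilings (the text of `SlackCeilings` with `∀ β ∃ L₀ … L₀ ≤ L`, the
output of `SlackLargeTransfer`) `→ FloorsCond (= OnsetCalibration.OnsetFloors) → InfiniteVolumeContinuum.HypercubicOSDataFromInfiniteVolume`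
(rung R2a-IV).  The «third twin»: verbatim the landed `slackCalibration_proof` (width seat w2 g22) with the per-order infinite-volume engine
carrying BOTH landed modifications at once — the UV slack `σ` and the volume threshold `L₀(β)` — namely
`InfiniteVolume.PerOrderSlackLarge.ivData_perOrderSlackLarge` (files `InfiniteVolumePerOrderSlackLarge{Compactness,TorusScheme,CentreBase,IVData}`,
this seat); the threshold of the hypothesis is chosen as a function of `β` by `choose` exactly as in the landed
`ThermodynamicCeilings.largeVolumeCalibration_proof` (width seat w2 g21; below the calibration threshold the clause is vacuous).  Unit
`a(β)` = an onset resolution above half the top of the onset set; `a → 0` by the LANDED `OnsetCalibration.onsetVanishes_proof`; floors at `a`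
by membership; ceilings at `a` because every `s' ≥ 2a(β)` carries no floor; E0′ output `‖S₁ n F‖ ≤ 7(A + B·C n^κ)ⁿ‖F‖_{(σ+10)n}` of linear
growth (exponent `1+κ`); reflection positivity, hermiticity and hyperoctahedral invariance by the landed theorems BY NAME.
Width seat `ym-line-sfw-p2-w2` g23 (cell ym-idea-1, free hands).

HONEST LABEL: this closes only a glue/support item; the leaf then rests on the OPEN cruxes `SqrtDominationC`, `SlackLargeMirrorCeiling`
(through `SlackLargeTransfer`) and `FloorsCond` (= the NT residual `OnsetFloors`).  No summit, no mass gap and no Clay statement is proved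
here; rung R2a RECORD label only.

References: K. Osterwalder, R. Schrader, CMP 42 (1975) 281–305 [OsterwalderSchrader1975] (§2, E0′); J. Glimm, A. Jaffe, Quantum Physics
(1987) §6.1 [GlimmJaffe1987]; P. Kravchuk, J. Qiao, S. Rychkov, arXiv:2104.02090 (Rem. 2.4).
-/

set_option autoImplicit false

noncomputable section

open scoped BigOperators SchwartzMap
open MeasureTheory Filter Topology
open Literature.MathematicalPhysics.QuantumFieldTheory Literature.MathematicalPhysics.QuantumLattice
open Literature.MathematicalPhysics.AQFT
open Literature.Probability.LatticeModels (Site)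
open Summit.QuantumFields.YangMills.Cruxes.OSLegsFromFemtoAndGap.DlrCollarTransfer
open Summit.QuantumFields.YangMills.Theorems.InfiniteVolume (stateMomentStr)
open Summit.QuantumFields.YangMills.Theorems.InfVolRP
open Summit.QuantumFields.YangMills.Theorems.OSLegsFromFemtoAndGap (pow_le_exp_mul_factorial)

namespace Summit.QuantumFields.YangMills.Theorems.SlackWindow

/-- **Support `SlackLargeCalibration` of route `SlackWindow`** (stmt-QuantumFields-23561): large-volume slack factorial sub-onset ceilings →
`OnsetFloors` → `HypercubicOSDataFromInfiniteVolume`, by the calibration of `slackCalibration_proof` run with the slack-large per-order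
infinite-volume engine (threshold `L₀(β)` chosen by `choose`).  Glue only. -/
theorem slackLargeCalibration_proof :
    Summit.QuantumFields.YangMills.Theses.SlackWindow.SlackLargeCalibration := by
  unfold Summit.QuantumFields.YangMills.Theses.SlackWindow.SlackLargeCalibration
  intro hK2 hK1 G _ _ _ _ hG hcl
  have hU := Summit.QuantumFields.YangMills.Theorems.OnsetCalibration.onsetVanishes_proof
  -- factorial currency is of linear growth (verbatim `TypicalExteriorCeilings.pow_affine_rpow_le_factorial`, inlined)
  have hgrowth : ∀ {A B C κ : ℝ}, 0 ≤ A → 0 ≤ B → 0 ≤ C → 0 ≤ κ → ∀ n : ℕ,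
      (A + B * (C * (n : ℝ) ^ κ)) ^ n ≤ Real.exp ((A + B * C) * Real.exp κ) * ((n.factorial : ℝ)) ^ (1 + κ) := by
    intro A B C κ hA hB hC hκ n
    rcases Nat.eq_zero_or_pos n with rfl | hn
    · simp only [pow_zero, Nat.factorial_zero, Nat.cast_one, Real.one_rpow, mul_one]
      exact Real.one_le_exp (by positivity)
    have hn1 : (1 : ℝ) ≤ n := by exact_mod_cast hn
    have hn0 : (0 : ℝ) ≤ n := by positivity
    have hnk : 1 ≤ (n : ℝ) ^ κ := Real.one_le_rpow hn1 hκ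
    have hfac : (0 : ℝ) < n.factorial := by exact_mod_cast n.factorial_pos
    set M : ℝ := A + B * C with hM
    have hM0 : 0 ≤ M := by positivity
    -- `A + BCn^κ ≤ M n^κ`
    have h1 : A + B * (C * (n : ℝ) ^ κ) ≤ M * (n : ℝ) ^ κ := by
      have hA' : A ≤ A * (n : ℝ) ^ κ := le_mul_of_one_le_right hA hnk
      have : M * (n : ℝ) ^ κ = A * (n : ℝ) ^ κ + B * (C * (n : ℝ) ^ κ) := by rw [hM]; ring
      linarith
    have h2 : (A + B * (C * (n : ℝ) ^ κ)) ^ n ≤ (M * (n : ℝ) ^ κ) ^ n := pow_le_pow_left₀ (by positivity) h1 n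
    -- `(n^κ)ⁿ = (nⁿ)^κ ≤ (eⁿ·n!)^κ = (e^κ)ⁿ·(n!)^κ`
    have h3 : ((n : ℝ) ^ κ) ^ n = ((n : ℝ) ^ n) ^ κ := by
      rw [← Real.rpow_natCast ((n : ℝ) ^ κ) n, ← Real.rpow_mul hn0, mul_comm, Real.rpow_mul hn0, Real.rpow_natCast]
    have h4 : (n : ℝ) ^ n ≤ Real.exp n * n.factorial := pow_le_exp_mul_factorial hn0 n
    have h5 : ((n : ℝ) ^ n) ^ κ ≤ (Real.exp n * n.factorial) ^ κ := Real.rpow_le_rpow (by positivity) h4 hκ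
    have h6 : (Real.exp n * (n.factorial : ℝ)) ^ κ = Real.exp κ ^ n * (n.factorial : ℝ) ^ κ := by
      rw [Real.mul_rpow (Real.exp_pos _).le hfac.le, ← Real.exp_mul, mul_comm (n : ℝ) κ, Real.exp_mul,
        Real.rpow_natCast]
    -- `(M e^κ)ⁿ ≤ e^{M e^κ}·n!`
    have h7 : (M * Real.exp κ) ^ n ≤ Real.exp (M * Real.exp κ) * n.factorial :=
      pow_le_exp_mul_factorial (by positivity) n
    have h8 : ((n.factorial : ℝ)) ^ (1 + κ) = (n.factorial : ℝ) * (n.factorial : ℝ) ^ κ := by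
      rw [Real.rpow_add hfac, Real.rpow_one]
    calc (A + B * (C * (n : ℝ) ^ κ)) ^ n ≤ (M * (n : ℝ) ^ κ) ^ n := h2
      _ = M ^ n * ((n : ℝ) ^ n) ^ κ := by rw [mul_pow, h3]
      _ ≤ M ^ n * (Real.exp κ ^ n * (n.factorial : ℝ) ^ κ) := by
          rw [← h6]; exact mul_le_mul_of_nonneg_left h5 (pow_nonneg hM0 n)
      _ = (M * Real.exp κ) ^ n * (n.factorial : ℝ) ^ κ := by rw [mul_pow]; ring
      _ ≤ (Real.exp (M * Real.exp κ) * n.factorial) * (n.factorial : ℝ) ^ κ :=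
          mul_le_mul_of_nonneg_right h7 (Real.rpow_nonneg hfac.le _)
      _ = Real.exp (M * Real.exp κ) * ((n.factorial : ℝ)) ^ (1 + κ) := by rw [h8]; ring
  letI : MeasurableSpace G := borel G
  haveI : BorelSpace G := ⟨rfl⟩
  -- K1: the floor datum
  obtain ⟨r, v, f, g, h, ε₁, Λ₅, β₅, hv, hfg, hgh, hfh, hε₁, hfloor⟩ := hK1 G hG hcl
  -- the factorial ceilings at that datum: the admissible floor levels
  obtain ⟨ε₀, hε₀, hK2'⟩ := hK2 G hG hcl r v f g h Λ₅
  have hεpos : 0 < min ε₁ ε₀ := lt_min hε₁ hε₀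
  -- the level `ε := min ε₁ ε₀` is live from `β₅` on
  have hlive : ∀ β : ℝ, β₅ ≤ β → ∃ s : ℝ, 0 < s ∧ s ≤ 1 ∧
      (∀ L : ℕ, Λ₅ ≤ s * L → min ε₁ ε₀ ≤ Q2 G r β L s (thetaTest 4 v) v) ∧
      (∀ L : ℕ, Λ₅ ≤ s * L → min ε₁ ε₀ ≤ |Q3 G r β L s f g h|) := by
    intro β hβ
    obtain ⟨s, hs0, hs1, h2, h3⟩ := hfloor β hβ
    exact ⟨s, hs0, hs1, fun L hL => (min_le_left _ _).trans (h2 L hL),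
      fun L hL => (min_le_left _ _).trans (h3 L hL)⟩
  obtain ⟨σ, C, κ, ℓ₄, β₄, hℓ₄, hC, hκ, hceil⟩ := hK2' (min ε₁ ε₀) hεpos (min_le_right _ _) ⟨β₅, hlive⟩
  -- the onset set `S β` (opaque, with its membership lemma)
  obtain ⟨S, hS⟩ : ∃ S : ℝ → Set ℝ, ∀ β s, s ∈ S β ↔ (0 < s ∧ s ≤ 1 ∧
      (∀ L : ℕ, Λ₅ ≤ s * L → min ε₁ ε₀ ≤ Q2 G r β L s (thetaTest 4 v) v) ∧
      (∀ L : ℕ, Λ₅ ≤ s * L → min ε₁ ε₀ ≤ |Q3 G r β L s f g h|)) :=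
    ⟨fun β => {s | 0 < s ∧ s ≤ 1 ∧
      (∀ L : ℕ, Λ₅ ≤ s * L → min ε₁ ε₀ ≤ Q2 G r β L s (thetaTest 4 v) v) ∧
      (∀ L : ℕ, Λ₅ ≤ s * L → min ε₁ ε₀ ≤ |Q3 G r β L s f g h|)}, fun _ _ => Iff.rfl⟩
  have hSbdd : ∀ β, BddAbove (S β) := fun β => ⟨1, fun s hs => ((hS β s).1 hs).2.1⟩
  have hSne : ∀ β : ℝ, β₅ ≤ β → (S β).Nonempty := fun β hβ => by
    obtain ⟨s, hs0, hs1, h2, h3⟩ := hlive β hβ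
    exact ⟨s, (hS β s).2 ⟨hs0, hs1, h2, h3⟩⟩
  -- the calibrated unit: an onset resolution above half the top of the onset set
  have hex : ∀ β : ℝ, ∃ s : ℝ, 0 < s ∧ ((S β).Nonempty → s ∈ S β ∧ sSup (S β) / 2 < s) := by
    intro β
    by_cases hne : (S β).Nonempty
    · have hpos : 0 < sSup (S β) := by
        obtain ⟨s, hs⟩ := hne
        exact lt_of_lt_of_le ((hS β s).1 hs).1 (le_csSup (hSbdd β) hs)
      obtain ⟨s, hs, hlt⟩ := exists_lt_of_lt_csSup hne (show sSup (S β) / 2 < sSup (S β) by linarith)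
      exact ⟨s, ((hS β s).1 hs).1, fun _ => ⟨hs, hlt⟩⟩
    · exact ⟨1, one_pos, fun h' => (hne h').elim⟩
  choose a ha_pos ha_mem using hex
  -- U: the unit tends to zero
  have ha0 : Tendsto a atTop (nhds 0) := by
    rw [Metric.tendsto_atTop]
    intro s₀ hs₀
    obtain ⟨β₁, hβ₁⟩ := hU G hG hcl r v f g h (min ε₁ ε₀) Λ₅ s₀ hεpos hs₀
    refine ⟨max β₁ β₅, fun β hβ => ?_⟩
    have hmem := (hS β (a β)).1 ((ha_mem β (hSne β (le_of_max_le_right hβ))).1)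
    rw [Real.dist_0_eq_abs, abs_of_pos (ha_pos β)]
    exact lt_of_not_ge fun hcon => hβ₁ β (le_of_max_le_left hβ) (a β) hcon hmem.2.1 ⟨hmem.2.2.1, hmem.2.2.2⟩
  -- the floors at the calibrated unit, by membership
  have hlb : LowerBounds G r a := by
    refine ⟨⟨v, min ε₁ ε₀, β₅, Λ₅, hv, hεpos, fun β hβ L hL => ?_⟩,
      ⟨f, g, h, min ε₁ ε₀, β₅, Λ₅, hfg, hgh, hfh, hεpos, fun β hβ L hL => ?_⟩⟩
    · have hmem := (hS β (a β)).1 ((ha_mem β (hSne β hβ)).1)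
      exact hmem.2.2.1 L hL
    · have hmem := (hS β (a β)).1 ((ha_mem β (hSne β hβ)).1)
      exact hmem.2.2.2 L hL
  -- the LARGE-VOLUME SLACK factorial ceilings at the calibrated unit (per-order collar constant `C n^κ`, UV slack `σ`), on tori
  -- `L ≥ L₀(β)`: every `s' ≥ 2 a β` lies above the onset set; the threshold is a function of `β`
  have hmb0 : ∀ β : ℝ, ∃ L₀ : ℕ, max β₄ β₅ ≤ β →
      ∀ (L n : ℕ) (q : Fin n → Fin 4 × Fin 4) (x : Fin n → (Fin 4 → ℤ)) (R : ℕ), (∀ i, (q i).1 < (q i).2) →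
        1 ≤ R → (R : ℝ) * a β ≤ ℓ₄ → 4 * R + 8 ≤ L → L₀ ≤ L →
        (∀ i j : Fin n, i ≠ j → ∃ k : Fin 4,
          (2 * (R : ℤ) + 4) ≤ |((((x i k - x j k : ℤ) : ZMod (2 * L + 1))).valMinAbs : ℤ)|) →
        |torusE G r β L (fun U => ∏ i, (plane G r (q i) (x i) U - torusE G r β L (plane G r (q i) (x i))))| ≤
          (C * (n : ℝ) ^ κ / (R : ℝ) ^ 4 * (((R : ℝ) * a β)⁻¹) ^ σ) ^ n := by
    intro β
    by_cases hβ : max β₄ β₅ ≤ β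
    · obtain ⟨L₀, hL₀⟩ := hceil β (le_of_max_le_left hβ)
      refine ⟨L₀, fun _ L n q x R hq hR hRa hRL hL₀L hsep => ?_⟩
      have hne := hSne β (le_of_max_le_right hβ)
      have hmem := (hS β (a β)).1 ((ha_mem β hne).1)
      have hhalf := (ha_mem β hne).2
      refine hL₀ (a β) hmem.1 hmem.2.1 ?_ L n q x R hq hR hRa hRL hL₀L hsep
      intro s' h2s hs1 hFl
      have hs'mem : s' ∈ S β := (hS β s').2 ⟨by linarith [ha_pos β], hs1, hFl.1, hFl.2⟩
      have := le_csSup (hSbdd β) hs'mem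
      linarith
    · exact ⟨0, fun h' => absurd h' hβ⟩
  choose L₀ hL₀ using hmb0
  -- the per-order infinite-volume engine on large tori
  obtain ⟨βk, μ, S₁, T, hdata, hN, ⟨A, B, hA, hB, hbd⟩, hSym, hTr, hNT, hNG⟩ :=
    Summit.QuantumFields.YangMills.Theorems.InfiniteVolume.PerOrderSlackLarge.ivData_perOrderSlackLarge r a ha_pos ha0 hlb
      (fun n => C * (n : ℝ) ^ κ) σ L₀ hℓ₄ (fun n => by positivity) (fun β hβ => hL₀ β hβ)
  obtain ⟨hβ, hμ, h0, h1, hS', hT⟩ := id hdata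
  -- a faithful continuous matrix representation of the compact group makes it Hausdorff and second countable
  haveI : T2Space G := (r.continuous.isClosedEmbedding r.injective).isEmbedding.t2Space
  haveI : SecondCountableTopology G :=
    (r.continuous.isClosedEmbedding r.injective).isEmbedding.secondCountableTopology
  -- E2: exact lattice reflection positivity inherited along the limit (landed, BY NAME)
  have hβev : ∀ᶠ k in atTop, 0 ≤ βk k := hβ.eventually_ge_atTop 0
  have hrp := rpPos_of_oddTorusLimitStates_centre r hβev μ hμ (fun k => ha_pos (βk k)) (ha0.comp hβ) T
    (fun n hn q hq F hF => by
      have hpt : ∀ (k : ℕ) (x : Fin n → Site 4),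
          (fun l => a (βk k) • (siteToE (x l) + centreOffset (q l))) =
            fun l => a (βk k) • siteToE (x l) +
              (a (βk k) / 2) • (EuclideanSpace.single (q l).1 (1 : ℝ) + EuclideanSpace.single (q l).2 (1 : ℝ)) :=
        fun k x => funext fun l => by
          unfold centreOffset
          rw [if_pos (hq l), smul_add, smul_smul, mul_one_div]
      simp_rw [hpt]
      exact hT n hn q hq F hF) S₁ hS' h0 h1
  have hE2 := hrp.2
  have hE0h := Summit.QuantumFields.YangMills.Theorems.OSLegsFromFemtoAndGap.isHermitian_of_isReflectionPositive
    S₁ hN hE2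
  -- E0′: the factorial currency is of linear growth, exponent `1 + κ`
  have hLG : S₁.toLabelled.HasLinearGrowth := by
    intro _
    refine ⟨σ + 10, 7 * Real.exp ((A + B * C) * Real.exp κ), 1 + κ, fun n k _ F _ => ?_⟩
    simp only [SchwingerFamily.toLabelled_apply]
    calc ‖S₁ n F‖ ≤ 7 * (A + B * (C * (n : ℝ) ^ κ)) ^ n * schwartzNorm ((σ + 10) * n) F := hbd n F
      _ ≤ 7 * (Real.exp ((A + B * C) * Real.exp κ) * ((n.factorial : ℝ)) ^ (1 + κ)) * schwartzNorm ((σ + 10) * n) F := by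
          gcongr
          · exact schwartzNorm_nonneg _ _
          · exact hgrowth hA hB hC hκ n
      _ = 7 * Real.exp ((A + B * C) * Real.exp κ) * ((n.factorial : ℝ)) ^ (1 + κ) * schwartzNorm (n * (σ + 10)) F := by
          rw [mul_comm n (σ + 10)]; ring
  -- hyperoctahedral invariance on ⁰𝒮: exact on the lattice, passes to the limit (E1.stub_ivSigned, by name)
  have hW4 := Summit.QuantumFields.YangMills.Theorems.InfiniteVolume.E1.stub_ivSigned r a βk μ S₁ T ha_pos hμ h0 h1
    hS' hT
  exact ⟨r, a, βk, μ, S₁, T, ha_pos, ha0, hdata, hN, hE0h, hLG, fun R hR n F hF => hW4 R hR n F hF, hE2, hSym,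
    hTr, hNT, hNG⟩


end Summit.QuantumFields.YangMills.Theorems.SlackWindow

end
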